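import Mathlib.Analysis.Fourier.ZMod
import Mathlib.NumberTheory.GaussSum
import Mathlib.NumberTheory.LegendreSymbol.JacobiSymbol
import Mathlib.NumberTheory.LegendreSymbol.QuadraticChar.Basic
import HarnessLib

/-!
# Crux `PrintCFram.BottomClassIndexLawFiveLe` (stmt-BirchSwinnertonDyer-20372), line `eisenstein-resource-bdp-line`,
# registry v27 `stub_flipRung` — typing item (T1): THE FINITE FOURIER LEMMA OF THE FLIPPED-CUSP RUNG, part 1
# (cell `bsd-print-cfram`, width seat `bsd-line-cfram-p1-w6` g9; THEOREMS ONLY, `--supports` 20372; BSD is not proved by any of this)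

HONEST FRAMING. Nothing here is a statement about BSD or about modular forms; no registered stub is closed. LEAD g14's
flipped-cusp rung (crux notes `Lines/eisenstein-resource-bdp-line-lead-g14.md` §2.1) cuts a `q`-expansion `f = ∑ a(n) e(nz)`
along a Legendre class at an odd prime `q`,
`P_σ f := ∑_{q ∥ n, J(n/q | q) = σ} a(n) e(nz) = (1/q²) ∑_{j mod q²} h_σ(j) f(z + j/q²)`, `h_σ(j) := ∑_{u mod q, (u/q) = σ} e(−uj/q)`,
and reads `(P_σ f) ∣ W_Q` at the flipped cusp through the finite sum `S(ξ) = ∑_{j ∈ (ℤ/q²ℤ)ˣ} h_σ(j) e(y_j ξ/q²)`. This file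
and its sequel `…FlipRungFourierMoment` supply the FINITE FOURIER ANALYSIS on `ℤ/q²ℤ` behind both identities, in Mathlib
currency (`ZMod.stdAddChar`, `gaussSum`, `quadraticChar`, `jacobiSym`) and in the `b`-vector shape of the tree's periodic twist
(`Literature.NumberTheory.ModularForms.PeriodicTwist.exists_modularForm_qExpansion_coeff_eq_mul`: `∑_j b(j)·ψ(j n) = a(n)`).
No definitions: the weight `h_σ` is written in CLOSED FORM `h_σ(j) = ½·(c_q(j) + σ·J(−j | q)·g_q)` (`c_q` = Ramanujan's sum,
`g_q` = the quadratic Gauss sum), which §3 proves equal to the defining sum.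

## Contents (all `q`-periodic bookkeeping is reduced to ONE master factorisation)
* §1 `sum_univ_zmod_eq_sum_range`, `sum_range_sq_eq_sum_sum`, `stdAddChar_sq_natMul` (`e(q·x/q²) = e(x/q)`),
  **`sum_sq_periodic_mul_stdAddChar`**: for `q`-periodic `H`,
  `∑_{j mod q²} H(j) e(jn/q²) = (∑_{a<q} H(a) e(an/q²))·(∑_{t mod q} e(tn/q))`, whence `= 0` if `q ∤ n`
  (`…_of_not_dvd`) and `= q·∑_{i mod q} H(i) e(iu/q)` at `n = qu` (`…_of_dvd`).
* §2 `quadraticChar_ringHomComp_intCast/_apply/_ne_one` (the complex quadratic character is `J(· | q)`),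
  **`gaussSum_quadratic_sq`** (`g_q² = J(−1|q)·q`, Mathlib `gaussSum_sq`), `gaussSum_quadratic_ne_zero`,
  **`sum_stdAddChar_ne_zero`** (Ramanujan: `∑_{x ≠ 0} e(xu/q) = q − 1` or `−1`),
  **`sum_jacobiSym_mul_stdAddChar`** (`∑_x J(x|q) e(xu/q) = J(u|q)·g_q`).
* §3 **`sum_legendreClass_stdAddChar_eq`** (`h_σ` = its closed form), `legendreClassWeight_of_dvd/_of_not_dvd/_periodic`.
The cut identity and the flipped-cusp moment `S(ξ)` are in the sequel file.

References: LEAD g14 crux notes §2.1 (this crux's `Cruxes/…/Lines/eisenstein-resource-bdp-line-lead-g14.md`); G. Shimura,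
*Introduction to the arithmetic theory of automorphic functions* (1971) Prop. 3.64 (translate averages); Mathlib
`Mathlib.Analysis.Fourier.ZMod`, `Mathlib.NumberTheory.GaussSum`. beyond-print theorem: NO (finite Fourier analysis).
-/

set_option autoImplicit false
-- summit-side namespace `Summit.BirchSwinnertonDyer.BirchSwinnertonDyer.…` (single-conjunct summit, D-0017 layout)
set_option linter.dupNamespace false

open scoped NumberTheorySymbols
open Complex Finset

namespace Summit.BirchSwinnertonDyer.BirchSwinnertonDyer.Theorems.PrintCFram.FlipRung

/-! ## §1 Sums over `ℤ/q²ℤ` of `q`-periodic functions against the additive character -/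

/-- Sums over `ZMod N` are sums over the representatives `0 ≤ m < N`. -/
theorem sum_univ_zmod_eq_sum_range {N : ℕ} [NeZero N] (F : ZMod N → ℂ) :
    ∑ j : ZMod N, F j = ∑ m ∈ range N, F (m : ZMod N) := by
  refine Finset.sum_nbij' (fun j ↦ j.val) (fun m ↦ (m : ZMod N)) (fun j _ ↦ ?_) (fun m _ ↦ mem_univ _)
    (fun j _ ↦ ?_) (fun m hm ↦ ?_) (fun j _ ↦ ?_)
  · exact mem_range.mpr (ZMod.val_lt j)
  · exact ZMod.natCast_zmod_val j
  · exact ZMod.val_cast_of_lt (mem_range.mp hm)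
  · rw [ZMod.natCast_zmod_val]

/-- `∑_{m < q²} f m = ∑_{b < q} ∑_{a < q} f (a + q b)`. -/
theorem sum_range_sq_eq_sum_sum (q : ℕ) (hq : 0 < q) (f : ℕ → ℂ) :
    ∑ m ∈ range (q ^ 2), f m = ∑ b ∈ range q, ∑ a ∈ range q, f (a + q * b) := by
  rw [← Finset.sum_product']
  refine Finset.sum_nbij' (fun m ↦ (m / q, m % q)) (fun p ↦ p.2 + q * p.1) (fun m hm ↦ ?_)
    (fun p hp ↦ ?_) (fun m _ ↦ ?_) (fun p hp ↦ ?_) (fun m _ ↦ ?_)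
  · rw [mem_range] at hm
    simp only [mem_product, mem_range]
    refine ⟨(Nat.div_lt_iff_lt_mul hq).mpr (by simpa [pow_two] using hm), Nat.mod_lt _ hq⟩
  · simp only [mem_product, mem_range] at hp
    rw [mem_range, pow_two]
    calc p.2 + q * p.1 < q + q * p.1 := by omega
      _ = q * (p.1 + 1) := by ring
      _ ≤ q * q := Nat.mul_le_mul_left q hp.1
  · exact Nat.mod_add_div m q
  · simp only [mem_product, mem_range] at hp
    ext
    · simp only
      rw [Nat.add_mul_div_left _ _ hq, Nat.div_eq_of_lt hp.2, zero_add]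
    · simp only
      rw [Nat.add_mul_mod_self_left, Nat.mod_eq_of_lt hp.2]
  · simp only
    rw [Nat.mod_add_div m q]

/-- The additive characters of `ℤ/q²ℤ` and `ℤ/qℤ`: `e(q·x / q²) = e(x / q)`. -/
theorem stdAddChar_sq_natMul (q : ℕ) [NeZero q] (x : ℤ) :
    ZMod.stdAddChar ((((q : ℤ) * x : ℤ)) : ZMod (q ^ 2)) = ZMod.stdAddChar ((x : ℤ) : ZMod q) := by
  rw [ZMod.stdAddChar_coe, ZMod.stdAddChar_coe]
  congr 1
  have hq : (q : ℂ) ≠ 0 := Nat.cast_ne_zero.mpr (NeZero.ne q)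
  push_cast
  field_simp

/-- **Master lemma.** For a `q`-periodic `H : ℕ → ℂ` and `n : ℤ`, the twisted sum of `H (j mod q)` against the
additive character of `ℤ/q²ℤ` factors:
`∑_{j mod q²} H(j) e(jn/q²) = (∑_{a<q} H(a) e(an/q²)) · (∑_{t mod q} e(tn/q))`. -/
theorem sum_sq_periodic_mul_stdAddChar (q : ℕ) [NeZero q] (H : ℕ → ℂ) (hH : Function.Periodic H q)
    (n : ℤ) :
    ∑ j : ZMod (q ^ 2), H j.val * ZMod.stdAddChar (j * (n : ZMod (q ^ 2))) =
      (∑ a ∈ range q, H a * ZMod.stdAddChar ((a : ZMod (q ^ 2)) * (n : ZMod (q ^ 2)))) *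
        ∑ t : ZMod q, ZMod.stdAddChar (t * (n : ZMod q)) := by
  have hq : 0 < q := Nat.pos_of_ne_zero (NeZero.ne q)
  rw [sum_univ_zmod_eq_sum_range (fun j : ZMod (q ^ 2) ↦ H j.val * ZMod.stdAddChar (j * (n : ZMod (q ^ 2)))),
    sum_univ_zmod_eq_sum_range (fun t : ZMod q ↦ ZMod.stdAddChar (t * (n : ZMod q))), Finset.sum_mul_sum,
    Finset.sum_comm, sum_range_sq_eq_sum_sum q hq]
  refine Finset.sum_congr rfl fun b hb ↦ Finset.sum_congr rfl fun a ha ↦ ?_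
  rw [mem_range] at ha hb
  have hlt : a + q * b < q ^ 2 := by
    rw [pow_two]
    calc a + q * b < q + q * b := by omega
      _ = q * (b + 1) := by ring
      _ ≤ q * q := Nat.mul_le_mul_left q hb
  rw [ZMod.val_cast_of_lt hlt, show H (a + q * b) = H a by
    rw [mul_comm]; exact hH.nat_mul b a, mul_assoc]
  congr 1
  rw [show ((a + q * b : ℕ) : ZMod (q ^ 2)) * (n : ZMod (q ^ 2)) =
      (a : ZMod (q ^ 2)) * (n : ZMod (q ^ 2)) + ((((q : ℤ) * ((b : ℤ) * n) : ℤ)) : ZMod (q ^ 2)) by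
    push_cast; ring, AddChar.map_add_eq_mul, stdAddChar_sq_natMul]
  push_cast
  ring_nf

/-- If `q ∤ n`, the twisted sum of any `q`-periodic function over `ℤ/q²ℤ` vanishes. -/
theorem sum_sq_periodic_mul_stdAddChar_of_not_dvd (q : ℕ) [NeZero q] (H : ℕ → ℂ)
    (hH : Function.Periodic H q) {n : ℤ} (hn : ¬ (q : ℤ) ∣ n) :
    ∑ j : ZMod (q ^ 2), H j.val * ZMod.stdAddChar (j * (n : ZMod (q ^ 2))) = 0 := by
  rw [sum_sq_periodic_mul_stdAddChar q H hH n]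
  have h0 : (n : ZMod q) ≠ 0 := by
    rwa [Ne, ZMod.intCast_zmod_eq_zero_iff_dvd]
  classical
  rw [AddChar.sum_mulShift (n : ZMod q) (ZMod.isPrimitive_stdAddChar q), if_neg h0, Nat.cast_zero, mul_zero]

/-- If `n = q u`, the twisted sum over `ℤ/q²ℤ` of a `q`-periodic function collapses to `q` times a sum over `ℤ/qℤ`:
`∑_{j mod q²} H(j) e(j·qu/q²) = q · ∑_{i mod q} H(i) e(iu/q)`. -/
theorem sum_sq_periodic_mul_stdAddChar_of_dvd (q : ℕ) [NeZero q] (H : ℕ → ℂ)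
    (hH : Function.Periodic H q) (u : ℤ) :
    ∑ j : ZMod (q ^ 2), H j.val * ZMod.stdAddChar (j * (((q : ℤ) * u : ℤ) : ZMod (q ^ 2))) =
      (q : ℂ) * ∑ i : ZMod q, H i.val * ZMod.stdAddChar (i * (u : ZMod q)) := by
  rw [sum_sq_periodic_mul_stdAddChar q H hH]
  have h1 : ∑ t : ZMod q, ZMod.stdAddChar (t * ((((q : ℤ) * u : ℤ)) : ZMod q)) = (q : ℂ) := by
    have : ((((q : ℤ) * u : ℤ)) : ZMod q) = 0 := by push_cast; simp
    simp [this]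
  rw [h1, mul_comm, sum_univ_zmod_eq_sum_range (fun i : ZMod q ↦ H i.val * ZMod.stdAddChar (i * (u : ZMod q)))]
  congr 1
  refine Finset.sum_congr rfl fun a ha ↦ ?_
  rw [mem_range] at ha
  rw [ZMod.val_cast_of_lt ha]
  congr 1
  rw [show (a : ZMod (q ^ 2)) * ((((q : ℤ) * u : ℤ)) : ZMod (q ^ 2)) =
      ((((q : ℤ) * ((a : ℤ) * u) : ℤ)) : ZMod (q ^ 2)) by push_cast; ring, stdAddChar_sq_natMul]
  push_cast
  ring_nf

/-! ## §2 Character sums mod `q`: the Ramanujan sum and the quadratic Gauss sum -/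

section CharSums

variable (q : ℕ) [Fact q.Prime]

/-- The complex quadratic character mod `q` is the Legendre/Jacobi symbol: `χ(a) = J(a | q)`. -/
theorem quadraticChar_ringHomComp_intCast (a : ℤ) :
    (quadraticChar (ZMod q)).ringHomComp (Int.castRingHom ℂ) (a : ZMod q) = (J(a | q) : ℂ) := by
  rw [MulChar.ringHomComp_apply, ← jacobiSym.legendreSym.to_jacobiSym, legendreSym, eq_intCast]

/-- `χ(j) = J(j.val | q)` for `j : ZMod q`. -/
theorem quadraticChar_ringHomComp_apply (j : ZMod q) :
    (quadraticChar (ZMod q)).ringHomComp (Int.castRingHom ℂ) j = (J((j.val : ℤ) | q) : ℂ) := by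
  rw [← quadraticChar_ringHomComp_intCast q (j.val : ℤ)]
  simp

/-- The complex quadratic character mod an odd prime `q` is nontrivial. -/
theorem quadraticChar_ringHomComp_ne_one (hq2 : q ≠ 2) :
    (quadraticChar (ZMod q)).ringHomComp (Int.castRingHom ℂ) ≠ 1 := by
  rw [Ne, MulChar.ringHomComp_eq_one_iff Int.cast_injective]
  exact quadraticChar_ne_one (by rwa [ZMod.ringChar_zmod_n])

omit [Fact q.Prime] in
/-- `J(−1 | q) ∈ {1, −1}`; in particular it is non-zero and squares to `1`. -/
theorem jacobiSym_neg_one_sq : (J(-1 | q) : ℤ) ^ 2 = 1 :=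
  jacobiSym.sq_one (by simp [Int.gcd])

/-- **`g² = q* = J(−1 | q)·q`** for the quadratic Gauss sum `g = ∑_{x mod q} J(x|q) e(x/q)` of an odd prime `q`
(Mathlib `gaussSum_sq`). -/
theorem gaussSum_quadratic_sq (hq2 : q ≠ 2) :
    gaussSum ((quadraticChar (ZMod q)).ringHomComp (Int.castRingHom ℂ)) (ZMod.stdAddChar (N := q)) ^ 2 =
      (J(-1 | q) : ℂ) * q := by
  rw [gaussSum_sq (quadraticChar_ringHomComp_ne_one q hq2) ((quadraticChar_isQuadratic (ZMod q)).comp _)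
    (ZMod.isPrimitive_stdAddChar q), ZMod.card, ← quadraticChar_ringHomComp_intCast q (-1)]
  push_cast
  rfl

/-- The quadratic Gauss sum of an odd prime is non-zero. -/
theorem gaussSum_quadratic_ne_zero (hq2 : q ≠ 2) :
    gaussSum ((quadraticChar (ZMod q)).ringHomComp (Int.castRingHom ℂ)) (ZMod.stdAddChar (N := q)) ≠ 0 := by
  intro h
  have h2 := gaussSum_quadratic_sq q hq2
  rw [h, zero_pow two_ne_zero] at h2
  have hq : (q : ℂ) ≠ 0 := Nat.cast_ne_zero.mpr (Nat.Prime.ne_zero Fact.out)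
  have hJ : (J(-1 | q) : ℂ) ≠ 0 := by
    intro h0
    have h1 := jacobiSym_neg_one_sq q
    have h0' : (J(-1 | q) : ℤ) = 0 := by exact_mod_cast h0
    rw [h0'] at h1
    norm_num at h1
  exact mul_ne_zero hJ hq h2.symm

/-- **Ramanujan's sum `c_q(u)`**: `∑_{x mod q, x ≠ 0} e(xu/q) = q − 1` if `q ∣ u`, and `= −1` otherwise. -/
theorem sum_stdAddChar_ne_zero (u : ℤ) :
    ∑ x : ZMod q, (if x = 0 then (0 : ℂ) else ZMod.stdAddChar (x * (u : ZMod q))) =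
      if (q : ℤ) ∣ u then ((q : ℂ) - 1) else -1 := by
  classical
  have hpt : ∀ x : ZMod q, (if x = 0 then (0 : ℂ) else ZMod.stdAddChar (x * (u : ZMod q))) =
      ZMod.stdAddChar (x * (u : ZMod q)) - if x = 0 then 1 else 0 := by
    intro x
    split_ifs with h
    · rw [h, zero_mul, AddChar.map_zero_eq_one, sub_self]
    · rw [sub_zero]
  simp_rw [hpt, Finset.sum_sub_distrib, Finset.sum_ite_eq', Finset.mem_univ, if_true]
  rw [AddChar.sum_mulShift (u : ZMod q) (ZMod.isPrimitive_stdAddChar q), ZMod.card]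
  by_cases hu : (q : ℤ) ∣ u
  · rw [if_pos ((ZMod.intCast_zmod_eq_zero_iff_dvd u q).mpr hu), if_pos hu]
  · rw [if_neg (mt (ZMod.intCast_zmod_eq_zero_iff_dvd u q).mp hu), if_neg hu, Nat.cast_zero, zero_sub]

/-- **The twisted quadratic Gauss sum**: `∑_{x mod q} J(x|q) e(xu/q) = J(u|q) · g` (`q` an odd prime). -/
theorem sum_jacobiSym_mul_stdAddChar (hq2 : q ≠ 2) (u : ℤ) :
    ∑ x : ZMod q, (J((x.val : ℤ) | q) : ℂ) * ZMod.stdAddChar (x * (u : ZMod q)) =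
      (J(u | q) : ℂ) * gaussSum ((quadraticChar (ZMod q)).ringHomComp (Int.castRingHom ℂ))
        (ZMod.stdAddChar (N := q)) := by
  set χ := (quadraticChar (ZMod q)).ringHomComp (Int.castRingHom ℂ) with hχ
  have hx : ∀ x : ZMod q, (J((x.val : ℤ) | q) : ℂ) = χ x := fun x ↦ (quadraticChar_ringHomComp_apply q x).symm
  simp_rw [hx]
  rw [← quadraticChar_ringHomComp_intCast q u]
  by_cases hu : ((u : ℤ) : ZMod q) = 0
  · rw [hu, MulChar.map_zero, zero_mul]
    simp only [mul_zero, AddChar.map_zero_eq_one, mul_one]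
    exact MulChar.sum_eq_zero_of_ne_one (quadraticChar_ringHomComp_ne_one q hq2)
  · have key := gaussSum_mulShift_eq χ (ZMod.stdAddChar (N := q)) (Ne.isUnit hu).unit
    rw [((quadraticChar_isQuadratic (ZMod q)).comp _).inv, IsUnit.unit_spec] at key
    rw [← hχ, ← key, gaussSum]
    refine Finset.sum_congr rfl fun x _ ↦ ?_
    rw [AddChar.mulShift_apply, mul_comm x]

end CharSums

/-! ## §3 The Legendre-class weight `h_σ` and the cut identity -/

section Cut

variable (q : ℕ) [Fact q.Prime]

/-- For `u : ZMod q`, `J(u.val | q) = 0 ↔ u = 0`, and otherwise `J(u.val | q) = ±1`. -/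
theorem jacobiSym_val_eq_zero_iff (u : ZMod q) : J((u.val : ℤ) | q) = 0 ↔ u = 0 := by
  rw [← jacobiSym.legendreSym.to_jacobiSym, legendreSym.eq_zero_iff]
  simp

/-- For `u : ZMod q` non-zero, `J(u.val | q) = 1 ∨ J(u.val | q) = -1`. -/
theorem jacobiSym_val_eq_one_or (u : ZMod q) (hu : u ≠ 0) :
    J((u.val : ℤ) | q) = 1 ∨ J((u.val : ℤ) | q) = -1 := by
  rw [← jacobiSym.legendreSym.to_jacobiSym]
  exact legendreSym.eq_one_or_neg_one q (by simpa using hu)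

/-- **The Legendre-class weight in closed form.** For an odd prime `q`, `σ = ±1` and `j : ℤ`,
`h_σ(j) := ∑_{u mod q, (u/q) = σ} e(−uj/q) = ½·(c_q(j) + σ·J(−j | q)·g_q)`, where `c_q(j)` is Ramanujan's sum (`q − 1` if `q ∣ j`,
else `−1`) and `g_q = ∑_x J(x|q) e(x/q)` the quadratic Gauss sum. (LEAD g14 crux notes §2.1, `h_σ`.) -/
theorem sum_legendreClass_stdAddChar_eq (hq2 : q ≠ 2) {σ : ℤ} (hσ : σ = 1 ∨ σ = -1) (j : ℤ) :
    ∑ u : ZMod q, (if J((u.val : ℤ) | q) = σ then ZMod.stdAddChar (-(u * (j : ZMod q))) else (0 : ℂ)) =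
      ((if (q : ℤ) ∣ j then ((q : ℂ) - 1) else -1) + σ * J(-j | q) *
        gaussSum ((quadraticChar (ZMod q)).ringHomComp (Int.castRingHom ℂ)) (ZMod.stdAddChar (N := q))) / 2 := by
  have hpt : ∀ u : ZMod q, (if J((u.val : ℤ) | q) = σ then ZMod.stdAddChar (-(u * (j : ZMod q))) else (0 : ℂ)) =
      ((if u = 0 then (0 : ℂ) else ZMod.stdAddChar (u * ((-j : ℤ) : ZMod q))) +
        σ * ((J((u.val : ℤ) | q) : ℂ) * ZMod.stdAddChar (u * ((-j : ℤ) : ZMod q)))) / 2 := by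
    intro u
    have harg : -(u * (j : ZMod q)) = u * ((-j : ℤ) : ZMod q) := by push_cast; ring
    rw [harg]
    by_cases hu : u = 0
    · rw [if_pos hu, (jacobiSym_val_eq_zero_iff q u).mpr hu, if_neg (by rcases hσ with h | h <;> simp [h])]
      simp
    · rw [if_neg hu]
      rcases jacobiSym_val_eq_one_or q u hu with h | h <;> rcases hσ with hs | hs <;> rw [h, hs] <;>
        norm_num
  simp_rw [hpt]
  rw [← Finset.sum_div, Finset.sum_add_distrib, ← Finset.mul_sum, sum_stdAddChar_ne_zero q (-j),
    sum_jacobiSym_mul_stdAddChar q hq2 (-j)]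
  simp_rw [dvd_neg]
  ring

/-- At `q ∣ j` the weight is `h_σ(j) = (q − 1)/2`, independently of `σ`. -/
theorem legendreClassWeight_of_dvd {σ : ℤ} {j : ℤ} (hj : (q : ℤ) ∣ j) (g : ℂ) :
    ((if (q : ℤ) ∣ j then ((q : ℂ) - 1) else -1) + σ * J(-j | q) * g) / 2 = ((q : ℂ) - 1) / 2 := by
  rw [if_pos hj, jacobiSym.mod_left, Int.emod_eq_zero_of_dvd (dvd_neg.mpr hj),
    jacobiSym.zero_left (Nat.Prime.one_lt Fact.out)]
  simp

omit [Fact q.Prime] in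
/-- At `q ∤ j` the weight is `h_σ(j) = (−1 + σ·J(−j|q)·g)/2`. -/
theorem legendreClassWeight_of_not_dvd {σ : ℤ} {j : ℤ} (hj : ¬ (q : ℤ) ∣ j) (g : ℂ) :
    ((if (q : ℤ) ∣ j then ((q : ℂ) - 1) else -1) + σ * J(-j | q) * g) / 2 = (-1 + σ * J(-j | q) * g) / 2 := by
  rw [if_neg hj]

omit [Fact q.Prime] in
/-- The weight `j ↦ h_σ(j)` is `q`-periodic (it only depends on `j mod q`). -/
theorem legendreClassWeight_periodic (σ : ℤ) (g : ℂ) :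
    Function.Periodic (fun a : ℕ ↦ ((if (q : ℤ) ∣ (a : ℤ) then ((q : ℂ) - 1) else -1) +
      σ * J(-(a : ℤ) | q) * g) / 2) q := by
  intro a
  simp only
  have h1 : ((q : ℤ) ∣ ((a + q : ℕ) : ℤ)) ↔ ((q : ℤ) ∣ (a : ℤ)) := by
    push_cast
    exact dvd_add_left (dvd_refl _)
  have h2 : J(-((a + q : ℕ) : ℤ) | q) = J(-(a : ℤ) | q) := by
    rw [jacobiSym.mod_left, jacobiSym.mod_left (-(a : ℤ))]
    congr 1
    push_cast
    rw [neg_add, Int.add_emod, Int.neg_emod_self] -- hmm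
    simp
  rw [h2]
  simp only [h1]

end Cut

end Summit.BirchSwinnertonDyer.BirchSwinnertonDyer.Theorems.PrintCFram.FlipRung
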